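import Literature.Barriers.Schanuel.NesterenkoModularScopeTransferToolkit
import Literature.NumberTheory.Transcendental.NesterenkoSymbolicPowers
import Mathlib.RingTheory.Ideal.MinimalPrime.Localization
import HarnessLib

/-!
# Barrier (Schanuel) `NesterenkoModularScope`: towards Proposition 3.6 of LNM 1752 Ch. 10 (projectivised), I — the `𝔭`-component of an ideal

Definitions-and-proofs sibling of `NesterenkoModularScope*.lean`; nothing is asserted as a fact.

In the chain construction of Prop. 3.6 (LNM 1752 Ch. 10 §3, pp. 157–159) one works, for a fixed
prime `𝔭` and the ideals `𝔞_n = (E₀, …, E_n)`, with "`𝔲_n`, the intersection of the primary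
components of `𝔞_n` contained in `𝔭`". This is the contraction `𝔞_n R_𝔭 ∩ R` — the component of
`𝔞_n` at `𝔭` — which this file introduces for an arbitrary commutative ring as
`locP 𝔭 I = {x ; ∃ s ∉ 𝔭, s x ∈ I}` (the same object as `GaGm.loc` of the tree's Philippon files,
there for `ℂ[X, Ȳ]`), together with its elementary API: monotonicity, `I ≤ locP 𝔭 I ≤ 𝔭` for
`I ≤ 𝔭`, idempotence, a uniform denominator in the Noetherian case, primality/primariness facts, and
behaviour on primes and primaries contained in `𝔭`.

## References

* [NesterenkoPhilippon2001] Yu. V. Nesterenko, P. Philippon (eds.), *Introduction to Algebraic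
  Independence Theory*, LNM 1752, Springer 2001, Ch. 10 §3, proof of Prop. 3.6, condition 3)
  and (64) (p. 158); Ch. 11 §2.3 (86) (the same component `I_𝔭 ∩ B`).
-/

noncomputable section

open MvPolynomial

namespace Literature.Barriers.Schanuel

namespace Transfer

section LocP

variable {R : Type*} [CommRing R]

/-- **The component of `I` at the prime `𝔭`**: `locP 𝔭 h𝔭 I = I R_𝔭 ∩ R = {x ; ∃ s ∉ 𝔭, s x ∈ I}`
(for `I ≤ 𝔭` with a primary decomposition: the intersection of the primary components of `I` whose
radical is contained in `𝔭`). [cite: NesterenkoPhilippon2001, Ch. 10 §3 proof of Prop. 3.6, 3) (p. 158); Ch. 11 §2.3 (86)] -/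
def locP (𝔭 : Ideal R) (h𝔭 : 𝔭.IsPrime) (I : Ideal R) : Ideal R where
  carrier := {x | ∃ s ∉ 𝔭, s * x ∈ I}
  zero_mem' := ⟨1, fun h => h𝔭.ne_top ((Ideal.eq_top_iff_one _).mpr h), by simp⟩
  add_mem' := by
    rintro f g ⟨s, hs, hsf⟩ ⟨t, ht, htg⟩
    refine ⟨s * t, fun h => (h𝔭.mem_or_mem h).elim hs ht, ?_⟩
    rw [mul_add]
    refine I.add_mem ?_ ?_
    · rw [mul_comm s t, mul_assoc]; exact I.mul_mem_left t hsf
    · rw [mul_assoc]; exact I.mul_mem_left s htg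
  smul_mem' := by
    rintro c f ⟨s, hs, hsf⟩
    refine ⟨s, hs, ?_⟩
    rw [smul_eq_mul, mul_left_comm]
    exact I.mul_mem_left c hsf

variable {𝔭 : Ideal R} (h𝔭 : 𝔭.IsPrime)

/-- Membership in the component, by definition. [folklore] -/
theorem mem_locP {I : Ideal R} {x : R} : x ∈ locP 𝔭 h𝔭 I ↔ ∃ s ∉ 𝔭, s * x ∈ I := Iff.rfl

/-- `I ≤ I R_𝔭 ∩ R`. [folklore] -/
theorem le_locP (I : Ideal R) : I ≤ locP 𝔭 h𝔭 I := fun x hx =>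
  ⟨1, fun h => h𝔭.ne_top ((Ideal.eq_top_iff_one _).mpr h), by simpa using hx⟩

/-- The component is monotone in the ideal. [folklore] -/
theorem locP_mono {I J : Ideal R} (h : I ≤ J) : locP 𝔭 h𝔭 I ≤ locP 𝔭 h𝔭 J := by
  rintro x ⟨s, hs, hsx⟩
  exact ⟨s, hs, h hsx⟩

/-- If `I ≤ 𝔭` then `I R_𝔭 ∩ R ≤ 𝔭`. [folklore] -/
theorem locP_le (I : Ideal R) (hI : I ≤ 𝔭) : locP 𝔭 h𝔭 I ≤ 𝔭 := by
  rintro x ⟨s, hs, hsx⟩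
  exact (h𝔭.mem_or_mem (hI hsx)).resolve_left hs

/-- The component of `𝔭` at itself is `𝔭`. [folklore] -/
theorem locP_self : locP 𝔭 h𝔭 𝔭 = 𝔭 :=
  le_antisymm (locP_le h𝔭 𝔭 le_rfl) (le_locP h𝔭 𝔭)

/-- More generally a prime `𝔮 ≤ 𝔭` is its own component at `𝔭`. [folklore] -/
theorem locP_eq_self_of_isPrime {𝔮 : Ideal R} (h𝔮 : 𝔮.IsPrime) (hle : 𝔮 ≤ 𝔭) : locP 𝔭 h𝔭 𝔮 = 𝔮 := by
  refine le_antisymm ?_ (le_locP h𝔭 𝔮)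
  rintro x ⟨s, hs, hsx⟩
  exact (h𝔮.mem_or_mem hsx).resolve_left fun h => hs (hle h)

/-- A primary ideal whose radical is contained in `𝔭` is its own component at `𝔭`. [folklore] -/
theorem locP_eq_self_of_isPrimary {Q : Ideal R} (hQ : Q.IsPrimary) (hle : Q.radical ≤ 𝔭) :
    locP 𝔭 h𝔭 Q = Q := by
  refine le_antisymm ?_ (le_locP h𝔭 Q)
  rintro x ⟨s, hs, hsx⟩
  rw [mul_comm] at hsx
  rcases (Ideal.isPrimary_iff.mp hQ).2 hsx with hx | hs'
  · exact hx
  · exact absurd (hle hs') hs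

/-- The component is idempotent. [folklore] -/
theorem locP_locP (I : Ideal R) : locP 𝔭 h𝔭 (locP 𝔭 h𝔭 I) = locP 𝔭 h𝔭 I := by
  refine le_antisymm ?_ (le_locP h𝔭 _)
  rintro x ⟨s, hs, t, ht, htsx⟩
  exact ⟨t * s, fun h => (h𝔭.mem_or_mem h).elim ht hs, by rwa [mul_assoc]⟩

/-- The component of an intersection is the intersection of the components. [folklore] -/
theorem locP_inf (I J : Ideal R) : locP 𝔭 h𝔭 (I ⊓ J) = locP 𝔭 h𝔭 I ⊓ locP 𝔭 h𝔭 J := by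
  refine le_antisymm (le_inf (locP_mono h𝔭 inf_le_left) (locP_mono h𝔭 inf_le_right)) ?_
  rintro x ⟨⟨s, hs, hsx⟩, ⟨t, ht, htx⟩⟩
  refine ⟨s * t, fun h => (h𝔭.mem_or_mem h).elim hs ht, ?_⟩
  refine ⟨?_, ?_⟩
  · rw [mul_comm s t, mul_assoc]; exact I.mul_mem_left t hsx
  · rw [mul_assoc]; exact J.mul_mem_left s htx

/-- The component of a finite intersection. [folklore] -/
theorem locP_finset_inf {ι : Type*} (t : Finset ι) (Q : ι → Ideal R) :
    locP 𝔭 h𝔭 (t.inf Q) = t.inf fun i => locP 𝔭 h𝔭 (Q i) := by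
  classical
  induction t using Finset.induction_on with
  | empty =>
    simp only [Finset.inf_empty]
    refine le_antisymm le_top fun x _ => ?_
    exact ⟨1, fun h => h𝔭.ne_top ((Ideal.eq_top_iff_one _).mpr h), by simp⟩
  | insert a t ha ih => rw [Finset.inf_insert, Finset.inf_insert, locP_inf, ih]

/-- A component not contained in `𝔭` is everything. [folklore] -/
theorem locP_eq_top_of_not_le {I : Ideal R} (hI : ¬ I ≤ 𝔭) : locP 𝔭 h𝔭 I = ⊤ := by
  obtain ⟨s, hsI, hs𝔭⟩ := Set.not_subset.mp hI
  rw [eq_top_iff]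
  intro x _
  exact ⟨s, hs𝔭, I.mul_mem_right x hsI⟩

/-- **The component through a primary decomposition**: if `I = ⋂ Qᵢ` with `Qᵢ` primary, then
`I R_𝔭 ∩ R` is the intersection of those `Qᵢ` with `√Qᵢ ≤ 𝔭`. [folklore] -/
theorem locP_eq_inf_filter {ι : Type*} [DecidableEq ι] {I : Ideal R} (t : Finset ι) (Q : ι → Ideal R)
    (hprim : ∀ i ∈ t, (Q i).IsPrimary) (hI : t.inf Q = I) [DecidablePred fun i => (Q i).radical ≤ 𝔭] :
    locP 𝔭 h𝔭 I = (t.filter fun i => (Q i).radical ≤ 𝔭).inf Q := by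
  rw [← hI, locP_finset_inf]
  refine le_antisymm ?_ ?_
  · refine Finset.le_inf fun i hi => ?_
    obtain ⟨hit, hirad⟩ := Finset.mem_filter.mp hi
    exact (Finset.inf_le hit).trans (locP_eq_self_of_isPrimary h𝔭 (hprim i hit) hirad).le
  · refine Finset.le_inf fun i hi => ?_
    by_cases hrad : (Q i).radical ≤ 𝔭
    · exact (Finset.inf_le (Finset.mem_filter.mpr ⟨hi, hrad⟩)).trans (le_locP h𝔭 _)
    · have hnot : ¬ Q i ≤ 𝔭 := fun h => hrad (h𝔭.radical_le_iff.mpr h)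
      rw [locP_eq_top_of_not_le h𝔭 hnot]
      exact le_top

/-- **A uniform denominator** for a finitely generated component: some `s ∉ 𝔭` multiplies all of
`I R_𝔭 ∩ R` into `I`. [folklore] -/
theorem exists_mul_locP_le [IsNoetherianRing R] (I : Ideal R) :
    ∃ s ∉ 𝔭, ∀ x ∈ locP 𝔭 h𝔭 I, s * x ∈ I := by
  classical
  obtain ⟨G, hG⟩ := (IsNoetherian.noetherian (locP 𝔭 h𝔭 I))
  have hmem : ∀ g ∈ G, ∃ s ∉ 𝔭, s * g ∈ I := fun g hg => by
    have : g ∈ locP 𝔭 h𝔭 I := by rw [← hG]; exact Ideal.subset_span hg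
    exact this
  choose! s hs hsI using hmem
  refine ⟨∏ g ∈ G, s g, ?_, ?_⟩
  · exact Finset.prod_induction s (fun x => x ∉ 𝔭) (fun a b ha hb h => (h𝔭.mem_or_mem h).elim ha hb)
      (fun h => h𝔭.ne_top ((Ideal.eq_top_iff_one _).mpr h)) (fun g hg => hs g hg)
  · intro x hx
    rw [← hG] at hx
    refine Submodule.span_induction (p := fun x _ => (∏ g ∈ G, s g) * x ∈ I) ?_ ?_ ?_ ?_ hx
    · intro g hg
      obtain ⟨u, hu⟩ : s g ∣ ∏ g' ∈ G, s g' := Finset.dvd_prod_of_mem s hg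
      rw [hu, mul_comm (s g) u, mul_assoc]
      exact I.mul_mem_left u (hsI g hg)
    · simp
    · intro a b _ _ ha hb
      rw [mul_add]; exact I.add_mem ha hb
    · intro c a _ ha
      rw [smul_eq_mul, mul_left_comm]
      exact I.mul_mem_left c ha

end LocP

end Transfer

end Literature.Barriers.Schanuel

end
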